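import Mathlib
import Literature.NumberTheory.Transcendental.KZProductIdeal
import Literature.NumberTheory.Transcendental.KZCalculusOver
import Summits.KontsevichZagierPeriods.KontsevichZagierPeriods.Theorems.SoloInformedProductOver
import HarnessLib

/-!
# `relations k` is a left ideal for the Fubini product of `KZ_k`

File of the solo-informed residency (s235), sequel of `SoloInformedProductOver` (the Fubini
product `soloInformedProdOver` of integral representations with coefficients in a ring `k`, and
the induced product on `KZOver.FormalRep k`).  This file proves that left products preserve the
relations of the calculus `KZ_k` — the four Kontsevich–Zagier moves with `k`-semialgebraic data
(`KZOver.relations k`) — for EVERY coefficient ring `k → ℝ`: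

* `soloInformed_ofOver_mul_mem_relations_of_mem_domainAddRel / …integrandAddRel /
  …newtonLeibnizRel / …changeOfVariablesRel` — each move is sent by `[t] × ·` to a move of the
  same kind: `τ × (σ₁ ∪ σ₂)` with `vol (τ × N) = vol τ · 0 = 0`; `g ⊗ (f₁ + f₂)`; a Newton–Leibniz
  band over `τ'` becomes a band over `τ × τ'` with primitive `g ⊗ F` (a `k`-semialgebraic
  function by Tarski–Seidenberg over `k`, `soloInformed_isSemialgebraicFunOn_cylOver_mul`); the
  block change of variables `(y, x) ↦ (y, Φ x)` with `|det| = |det Φ'|`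
  (`soloInformed_isSemialgebraicMapOn_blockMapOver`, no Tarski–Seidenberg).
* **`soloInformed_ofOver_mul_mem_relations`** — `c ∈ relations k → [t] * c ∈ relations k`;
  **`soloInformed_mul_mem_relationsOver_left`** — `c ∈ relations k → c' * c ∈ relations k`
  (`relations k` is a left ideal); `soloInformed_equivalentOver_prod_left`.

This is the coefficient-generic form of the Literature theorems `KZ.of_mul_mem_relations`,
`KZ.mul_mem_relations_left_holds` (`KZProductIdeal.lean`, `k = ℚ`), whose proofs it follows line
by line, and of the residency's `soloInformed_discMul_mem_relations` (`k = ℝ`, factor `[π]`).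
Commutativity modulo relations, the right-ideal property and the ring structure on
`FormalRep k ⧸ relations k` follow in the sequel files.  Bearing: residency verdict,
`paper/real-parameters.md` (S1) ("`P_ℝ` is a commutative `ℝ`-algebra"), kernel form; nothing here
bears on Conjecture 1 itself.

References: M. Kontsevich, D. Zagier, *Periods* (2001), §1.2 (rules (1)–(3)), §4.1 (p. 31);
J. Bochnak, M. Coste, M.-F. Roy, *Real Algebraic Geometry* (1998), §2.2, Prop. 2.2.6;
J. Cresson, J. Viu-Sos, JTNB 34 (2022), §1.
-/

noncomputable section

open Set MeasureTheory MvPolynomial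
open Literature.ModelTheory.ExponentialFields Literature.NumberTheory.Transcendental

namespace Summit.KontsevichZagierPeriods.KontsevichZagierPeriods.Theorems

variable {k : Type*} [CommRing k] [Algebra k ℝ] {l n m d : ℕ}

/-! ### Block maps `(y, x) ↦ (y, Φ x)` over `k` (no Tarski–Seidenberg) -/

/-- The block map `(y, x) ↦ (y, Φ x)` on a cylinder `A × σ` is a `k`-semialgebraic map when `Φ` is
`k`-semialgebraic on `σ`: its graph is the intersection of a coordinate preimage of the graph of
`Φ`, a coordinate preimage of `A`, and the coordinate equalities `y' = y`. -/
theorem soloInformed_isSemialgebraicMapOn_blockMapOver {A : Set (Fin l → ℝ)} {σ : Set (Fin n → ℝ)}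
    {Φ : (Fin n → ℝ) → (Fin n → ℝ)} (hA : IsSemialgebraic k A) (hΦ : IsSemialgebraicMapOn k σ Φ) :
    IsSemialgebraicMapOn k {z : Fin (l + n) → ℝ | (fun i => z (Fin.castAdd n i)) ∈ A ∧
        (fun j => z (Fin.natAdd l j)) ∈ σ}
      (fun z => Fin.append (fun i => z (Fin.castAdd n i)) (Φ fun j => z (Fin.natAdd l j))) := by
  rw [isSemialgebraicMapOn_iff]
  have hG := isSemialgebraicMapOn_iff.mp hΦ
  let ρ : Fin (n + n) → Fin (l + n + (l + n)) :=
    Fin.append (fun j => Fin.castAdd (l + n) (Fin.natAdd l j))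
      (fun j => Fin.natAdd (l + n) (Fin.natAdd l j))
  have h1 := hG.preimage_comp ρ
  have h2 := hA.preimage_comp (fun i : Fin l => Fin.castAdd (l + n) (Fin.castAdd n i))
  have h3 : IsSemialgebraic k (⋂ i ∈ (Finset.univ : Finset (Fin l)),
      {w : Fin (l + n + (l + n)) → ℝ |
        w (Fin.natAdd (l + n) (Fin.castAdd n i)) = w (Fin.castAdd (l + n) (Fin.castAdd n i))}) := by
    refine IsSemialgebraic.biInter Finset.univ _ fun i _ => ?_
    convert isSemialgebraic_setOf_eval_eq_zero (k := k) (R := ℝ)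
      (X (Fin.natAdd (l + n) (Fin.castAdd n i)) -
        X (Fin.castAdd (l + n) (Fin.castAdd n i)) : MvPolynomial (Fin (l + n + (l + n))) k) using 1
    ext w
    simp [sub_eq_zero]
  have hρa : ∀ (w : Fin (l + n + (l + n)) → ℝ) (i : Fin n),
      (w ∘ ρ) (Fin.castAdd n i) = w (Fin.castAdd (l + n) (Fin.natAdd l i)) := by
    intro w i
    simp only [Function.comp_apply, ρ, Fin.append_left]
  have hρb : ∀ (w : Fin (l + n + (l + n)) → ℝ) (j : Fin n),
      (w ∘ ρ) (Fin.natAdd n j) = w (Fin.natAdd (l + n) (Fin.natAdd l j)) := by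
    intro w j
    simp only [Function.comp_apply, ρ, Fin.append_right]
  convert h2.inter (h1.inter h3) using 1
  ext w
  simp only [mem_setOf_eq, mem_inter_iff, mem_preimage, mem_iInter, Finset.mem_univ, true_imp_iff,
    KZ.eq_append_iff]
  simp only [hρa, hρb]
  simp only [Function.comp_def, funext_iff]
  tauto

/-! ### The four moves under `[t] × ·` -/

section Moves

variable (t : KZOver.IntegralRep k l)

/-- **`[t] × (domain additivity)` is a domain-additivity move**:
`τ × (σ₁ ∪ σ₂) = (τ × σ₁) ∪ (τ × σ₂)` with `vol ((τ × σ₁) ∩ (τ × σ₂)) = vol τ · vol (σ₁ ∩ σ₂) = 0`,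
and `g ⊗ f = g ⊗ fᵢ` on `τ × σᵢ`. -/
theorem soloInformed_ofOver_mul_mem_relations_of_mem_domainAddRel {c : KZOver.FormalRep k}
    (hc : c ∈ KZOver.domainAddRel k) : KZOver.of t * c ∈ KZOver.relations k := by
  obtain ⟨n, r, r₁, r₂, hdom, hnull, h₁, h₂, rfl⟩ := hc
  rw [mul_sub, mul_sub, soloInformed_ofOver_mul_ofOver, soloInformed_ofOver_mul_ofOver,
    soloInformed_ofOver_mul_ofOver]
  refine KZOver.domainAddRel_subset_relations ⟨l + n, soloInformedProdOver t r,
    soloInformedProdOver t r₁, soloInformedProdOver t r₂, ?_, ?_, ?_, ?_, rfl⟩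
  · ext z
    simp only [soloInformed_prodOver_domain, soloInformed_mem_prodDomainOver, hdom, mem_union]
    tauto
  · have hsub : (soloInformedProdOver t r₁).domain ∩ (soloInformedProdOver t r₂).domain =
        {z : Fin (l + n) → ℝ | (fun i => z (Fin.castAdd n i)) ∈ t.domain ∧
          (fun j => z (Fin.natAdd l j)) ∈ r₁.domain ∩ r₂.domain} := by
      ext z
      simp only [soloInformed_prodOver_domain, mem_inter_iff, soloInformed_mem_prodDomainOver,
        mem_setOf_eq]
      tauto
    rw [hsub, KZ.volume_cylinder, hnull, mul_zero]
  · intro z hz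
    rw [soloInformed_prodOver_integrand, soloInformed_prodOver_integrand,
      soloInformed_prodFunOver_apply, soloInformed_prodFunOver_apply, h₁ hz.2]
  · intro z hz
    rw [soloInformed_prodOver_integrand, soloInformed_prodOver_integrand,
      soloInformed_prodFunOver_apply, soloInformed_prodFunOver_apply, h₂ hz.2]

/-- **`[t] × (integrand additivity)` is an integrand-additivity move**:
`g ⊗ (f₁ + f₂) = g ⊗ f₁ + g ⊗ f₂` on `τ × σ`. -/
theorem soloInformed_ofOver_mul_mem_relations_of_mem_integrandAddRel {c : KZOver.FormalRep k}
    (hc : c ∈ KZOver.integrandAddRel k) : KZOver.of t * c ∈ KZOver.relations k := by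
  obtain ⟨n, r, r₁, r₂, h₁, h₂, hadd, rfl⟩ := hc
  rw [mul_sub, mul_sub, soloInformed_ofOver_mul_ofOver, soloInformed_ofOver_mul_ofOver,
    soloInformed_ofOver_mul_ofOver]
  refine KZOver.integrandAddRel_subset_relations ⟨l + n, soloInformedProdOver t r,
    soloInformedProdOver t r₁, soloInformedProdOver t r₂, ?_, ?_, ?_, rfl⟩
  · ext z
    simp only [soloInformed_prodOver_domain, soloInformed_mem_prodDomainOver, h₁]
  · ext z
    simp only [soloInformed_prodOver_domain, soloInformed_mem_prodDomainOver, h₂]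
  · intro z hz
    rw [soloInformed_prodOver_integrand, soloInformed_prodOver_integrand,
      soloInformed_prodOver_integrand, Pi.add_apply, soloInformed_prodFunOver_apply,
      soloInformed_prodFunOver_apply, soloInformed_prodFunOver_apply, hadd hz.2, Pi.add_apply,
      mul_add]

/-- **`[t] × (Newton–Leibniz)` is a Newton–Leibniz move.** If `[r] − [r']` is rule (3) along the
last coordinate over the base `τ'` with bounds `a ≤ b` and primitive `F`, then
`τ × band = {(y, x, s) | (y, x) ∈ τ × τ', a x ≤ s ≤ b x}` is again a band in the last coordinate
(`Fin (l + (n + 1)) = Fin ((l + n) + 1)` definitionally) over the base `τ × τ'`, with bounds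
`a ∘ pr₂ ≤ b ∘ pr₂` and primitive `(y, x, s) ↦ g y · F (x, s)` — a `k`-semialgebraic function on
the band by Tarski–Seidenberg over `k`; fibrewise a constant multiple of the old primitive, so
continuity, the derivative and the boundary formula are inherited. -/
theorem soloInformed_ofOver_mul_mem_relations_of_mem_newtonLeibnizRel {c : KZOver.FormalRep k}
    (hc : c ∈ KZOver.newtonLeibnizRel k) : KZOver.of t * c ∈ KZOver.relations k := by
  obtain ⟨n, r, r', a, b, F, hF, ha, hb, hab, hdom, hcont, hderiv, hr', rfl⟩ := hc
  rw [mul_sub, soloInformed_ofOver_mul_ofOver, soloInformed_ofOver_mul_ofOver]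
  refine KZOver.newtonLeibnizRel_subset_relations ⟨l + n, (soloInformedProdOver t r :),
    soloInformedProdOver t r',
    fun z => a (fun j => z (Fin.natAdd l j)), fun z => b (fun j => z (Fin.natAdd l j)),
    fun w => t.integrand (fun i => w (Fin.castAdd (n + 1) i)) * F (fun j => w (Fin.natAdd l j)),
    ?_, ?_, ?_, ?_, ?_, ?_, ?_, ?_, rfl⟩
  · exact soloInformed_isSemialgebraicFunOn_cylOver_mul t.isSemialgebraic_domain
      r.isSemialgebraic_domain t.isSemialgebraicFunOn_integrand hF
  · exact soloInformed_isSemialgebraicFunOn_cylOver_right t.isSemialgebraic_domain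
      r'.isSemialgebraic_domain ha
  · exact soloInformed_isSemialgebraicFunOn_cylOver_right t.isSemialgebraic_domain
      r'.isSemialgebraic_domain hb
  · intro z hz
    exact hab _ hz.2
  · ext w
    change ((fun i => w (Fin.castAdd (n + 1) i)) ∈ t.domain ∧
        (fun j => w (Fin.natAdd l j)) ∈ r.domain) ↔ _
    rw [hdom]
    simp only [soloInformed_prodOver_domain, soloInformed_mem_prodDomainOver, mem_setOf_eq,
      KZ.init_castAdd, KZ.init_natAdd, KZ.apply_natAdd_last]
    tauto
  · intro z hz
    simp only [Fin.snoc_castAdd, KZ.snoc_natAdd]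
    exact continuousOn_const.mul (hcont _ hz.2)
  · intro z hz s hs
    simp only [Fin.snoc_castAdd, KZ.snoc_natAdd]
    refine ((hderiv _ hz.2 s hs).const_mul
      (t.integrand fun i => z (Fin.castAdd n i))).congr_deriv ?_
    rw [soloInformed_prodOver_integrand, soloInformed_prodFunOver_apply]
    simp only [Fin.snoc_castAdd, KZ.snoc_natAdd]
  · intro z hz
    rw [soloInformed_prodOver_integrand, soloInformed_prodFunOver_apply, hr' _ hz.2, mul_sub]
    simp only [Fin.snoc_castAdd, KZ.snoc_natAdd]

/-- **`[t] × (change of variables)` is a change-of-variables move**: for `Φ` on `σ` as in rule (2),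
the block map `Ψ (y, x) = (y, Φ x)` on `τ × σ` is `k`-semialgebraic
(`soloInformed_isSemialgebraicMapOn_blockMapOver`), injective, has derivative `id × Φ' x` within
`τ × σ` (chain rule through `ℝˡ × ℝⁿ ≃ ℝˡ⁺ⁿ`, `HasFDerivWithinAt.prodMap`), image `τ × Φ '' σ`,
and `|det (id × Φ' x)| = |det Φ' x|` (`LinearMap.det_conj`, `LinearMap.det_prodMap`), so
`g ⊗ f = (g ⊗ f') ∘ Ψ · |det Ψ'|` on `τ × σ`. -/
theorem soloInformed_ofOver_mul_mem_relations_of_mem_changeOfVariablesRel {c : KZOver.FormalRep k}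
    (hc : c ∈ KZOver.changeOfVariablesRel k) : KZOver.of t * c ∈ KZOver.relations k := by
  obtain ⟨n, r, r', Φ, Φ', hΦ, hΦ', hinj, hdom, hf, rfl⟩ := hc
  rw [mul_sub, soloInformed_ofOver_mul_ofOver, soloInformed_ofOver_mul_ofOver]
  -- the linear identification `ℝˡ × ℝⁿ ≃ ℝˡ⁺ⁿ`
  let e : ((Fin l → ℝ) × (Fin n → ℝ)) ≃ₗ[ℝ] (Fin (l + n) → ℝ) :=
    { toFun := fun p => Fin.append p.1 p.2
      invFun := fun z => (fun i => z (Fin.castAdd n i), fun j => z (Fin.natAdd l j))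
      map_add' := fun p q => by
        ext i; refine Fin.addCases (fun i => ?_) (fun j => ?_) i <;> simp
      map_smul' := fun c p => by
        ext i; refine Fin.addCases (fun i => ?_) (fun j => ?_) i <;> simp
      left_inv := fun p => by ext <;> simp
      right_inv := fun z => by
        ext i; refine Fin.addCases (fun i => ?_) (fun j => ?_) i <;> simp }
  let eL : ((Fin l → ℝ) × (Fin n → ℝ)) ≃L[ℝ] (Fin (l + n) → ℝ) := e.toContinuousLinearEquiv
  have heL : ∀ p, eL p = Fin.append p.1 p.2 := fun p => rfl
  have heL_symm : ∀ z, eL.symm z = (fun i => z (Fin.castAdd n i), fun j => z (Fin.natAdd l j)) :=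
    fun z => rfl
  -- the block map and its derivative
  let Ψ : (Fin (l + n) → ℝ) → (Fin (l + n) → ℝ) := eL ∘ Prod.map id Φ ∘ eL.symm
  let Ψ' : (Fin (l + n) → ℝ) → (Fin (l + n) → ℝ) →L[ℝ] (Fin (l + n) → ℝ) := fun z =>
    (eL : _ →L[ℝ] _).comp ((((ContinuousLinearMap.id ℝ (Fin l → ℝ)).prodMap
      (Φ' (fun j => z (Fin.natAdd l j)))).comp (eL.symm : _ →L[ℝ] _)))
  have hΨ : ∀ z, Ψ z = Fin.append (fun i => z (Fin.castAdd n i)) (Φ fun j => z (Fin.natAdd l j)) :=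
    fun z => rfl
  have hdet : ∀ z, (Ψ' z).det = (Φ' (fun j => z (Fin.natAdd l j))).det := by
    intro z
    have hcoe : ((Ψ' z : (Fin (l + n) → ℝ) →L[ℝ] (Fin (l + n) → ℝ)) :
        (Fin (l + n) → ℝ) →ₗ[ℝ] (Fin (l + n) → ℝ)) =
      (e : ((Fin l → ℝ) × (Fin n → ℝ)) →ₗ[ℝ] (Fin (l + n) → ℝ)) ∘ₗ
        (((LinearMap.id : (Fin l → ℝ) →ₗ[ℝ] (Fin l → ℝ)).prodMap
          ((Φ' (fun j => z (Fin.natAdd l j)) : (Fin n → ℝ) →L[ℝ] (Fin n → ℝ)) :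
            (Fin n → ℝ) →ₗ[ℝ] (Fin n → ℝ))) ∘ₗ
        (e.symm : (Fin (l + n) → ℝ) →ₗ[ℝ] ((Fin l → ℝ) × (Fin n → ℝ)))) :=
      LinearMap.ext fun v => rfl
    change LinearMap.det _ = LinearMap.det _
    rw [hcoe, LinearMap.det_conj, LinearMap.det_prodMap, LinearMap.det_id, one_mul]
  have hS : (soloInformedProdOver t r).domain = eL.symm ⁻¹' (t.domain ×ˢ r.domain) := rfl
  refine KZOver.changeOfVariablesRel_subset_relations
    ⟨l + n, soloInformedProdOver t r, soloInformedProdOver t r', Ψ, Ψ', ?_, ?_, ?_, ?_, ?_, rfl⟩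
  · exact (soloInformed_isSemialgebraicMapOn_blockMapOver t.isSemialgebraic_domain hΦ).congr
      fun z _ => (hΨ z).symm
  · intro z hz
    have hx : (fun j => z (Fin.natAdd l j)) ∈ r.domain := hz.2
    have hg : HasFDerivWithinAt (Prod.map id Φ)
        ((ContinuousLinearMap.id ℝ (Fin l → ℝ)).prodMap (Φ' (fun j => z (Fin.natAdd l j))))
        (t.domain ×ˢ r.domain) (eL.symm z) := by
      refine HasFDerivWithinAt.prodMap (eL.symm z) (hasFDerivWithinAt_id _ _) ((hΦ' _ hx).mono ?_)
      rintro _ ⟨q, hq, rfl⟩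
      exact hq.2
    have h2 := (eL.comp_hasFDerivWithinAt_iff).mpr hg
    have h3 := (eL.symm.comp_right_hasFDerivWithinAt_iff (f := eL ∘ Prod.map id Φ)).mpr h2
    rw [hS]
    exact h3
  · intro z₁ hz₁ z₂ hz₂ h
    rw [hΨ, hΨ] at h
    have h' := congrArg (fun w : Fin (l + n) → ℝ =>
      ((fun i => w (Fin.castAdd n i)), (fun j => w (Fin.natAdd l j)))) h
    simp only [Fin.append_left, Fin.append_right, Prod.mk.injEq] at h'
    have h2 : (fun j => z₁ (Fin.natAdd l j)) = fun j => z₂ (Fin.natAdd l j) := hinj hz₁.2 hz₂.2 h'.2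
    rw [← Fin.append_castAdd_natAdd (f := z₁), ← Fin.append_castAdd_natAdd (f := z₂), h'.1, h2]
  · ext w
    simp only [soloInformed_prodOver_domain, soloInformed_mem_prodDomainOver, hdom, mem_image]
    constructor
    · rintro ⟨hw₁, x, hx, hwx⟩
      refine ⟨Fin.append (fun i => w (Fin.castAdd n i)) x,
        ⟨by simpa using hw₁, by simpa using hx⟩, ?_⟩
      rw [hΨ]
      simp only [Fin.append_left, Fin.append_right]
      conv_rhs => rw [← Fin.append_castAdd_natAdd (f := w)]
      simp [hwx]
    · rintro ⟨z, hz, rfl⟩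
      rw [hΨ]
      simp only [Fin.append_left, Fin.append_right]
      exact ⟨by simpa using hz.1, _, hz.2, rfl⟩
  · intro z hz
    rw [soloInformed_prodOver_integrand, soloInformed_prodOver_integrand,
      soloInformed_prodFunOver_apply, hf _ hz.2, hdet, hΨ, soloInformed_prodFunOver_append,
      mul_assoc]

/-! ### Assembly: left products preserve `relations k` -/

/-- **`[t] × relations k ⊆ relations k`**: `c ∈ relations k → [t] * c ∈ relations k` for every
integral representation `t` over `k` (`AddSubgroup.closure_induction`, each generator being sent
to a move of the same kind and `[t] * ·` being additive). -/
theorem soloInformed_ofOver_mul_mem_relations {c : KZOver.FormalRep k} (hc : c ∈ KZOver.relations k) :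
    KZOver.of t * c ∈ KZOver.relations k := by
  refine AddSubgroup.closure_induction (fun x hx => ?_) ?_ (fun x y _ _ hx hy => ?_)
    (fun x _ hx => ?_) hc
  · rcases hx with ((hx | hx) | hx) | hx
    · exact soloInformed_ofOver_mul_mem_relations_of_mem_domainAddRel t hx
    · exact soloInformed_ofOver_mul_mem_relations_of_mem_integrandAddRel t hx
    · exact soloInformed_ofOver_mul_mem_relations_of_mem_changeOfVariablesRel t hx
    · exact soloInformed_ofOver_mul_mem_relations_of_mem_newtonLeibnizRel t hx
  · rw [mul_zero]; exact (KZOver.relations k).zero_mem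
  · rw [mul_add]; exact (KZOver.relations k).add_mem hx hy
  · rw [mul_neg]; exact (KZOver.relations k).neg_mem hx

/-- **Equivalent representations have equivalent left products**: `r ∼ r'` over `k` implies
`t × r ∼ t × r'` over `k`. -/
theorem soloInformed_equivalentOver_prod_left {r : KZOver.IntegralRep k n}
    {r' : KZOver.IntegralRep k m} (h : KZOver.Equivalent r r') :
    KZOver.Equivalent (soloInformedProdOver t r) (soloInformedProdOver t r') := by
  have h' := soloInformed_ofOver_mul_mem_relations t h
  rw [mul_sub, soloInformed_ofOver_mul_ofOver, soloInformed_ofOver_mul_ofOver] at h'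
  exact h'

end Moves

/-- **`relations k` is a left ideal of `KZOver.FormalRep k`**: `c ∈ relations k → c' * c ∈ relations k`
(additivity in `c'` from `soloInformed_ofOver_mul_mem_relations`). -/
theorem soloInformed_mul_mem_relationsOver_left (c' : KZOver.FormalRep k) {c : KZOver.FormalRep k}
    (hc : c ∈ KZOver.relations k) : c' * c ∈ KZOver.relations k := by
  induction c' using FreeAbelianGroup.induction_on with
  | zero => rw [zero_mul]; exact (KZOver.relations k).zero_mem
  | of x =>
    obtain ⟨l, t⟩ := x
    exact soloInformed_ofOver_mul_mem_relations t hc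
  | neg x ih => rw [neg_mul]; exact (KZOver.relations k).neg_mem ih
  | add x y hx hy => rw [add_mul]; exact (KZOver.relations k).add_mem hx hy

/-- Subgroup form: left multiplication by `c'` maps `relations k` into `relations k`. -/
theorem soloInformed_map_mulLeft_relationsOver_le (c' : KZOver.FormalRep k) :
    (KZOver.relations k).map (AddMonoidHom.mul c') ≤ KZOver.relations k := by
  rintro _ ⟨c, hc, rfl⟩
  exact soloInformed_mul_mem_relationsOver_left c' hc

end Summit.KontsevichZagierPeriods.KontsevichZagierPeriods.Theorems
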